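import Literature.MathematicalPhysics.QuantumLattice.GradedLocalGroundEnergyCut
import HarnessLib

/-!
# Pair-sourced Hubbard Hamiltonians restricted to a region, and Ruelle's cut over an arbitrary region

Topic `MathematicalPhysics/QuantumLattice` (sequel of `GradedLocalGroundEnergyCut.lean` and of the block-cut
file `SourcedHubbardBlockCut.lean`; written for the cell `hubbard-cq`, negation lens N-W0-LOCAL / census (13),
the site-local version of the sourced ε-lift barrier). For a finite linearly ordered site set `Λ`, bond
couplings `c : Bond Λ → ℂ` (`Bond Λ = Λ × Λ × Fin 2`, hopping term `c_b T_b`, `T_{(x,y,σ)} = c†_{xσ}c_{yσ}`),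
pair weights `w : Λ × Λ → ℂ` (source `h(P_w + P_wᴴ)`, `P_w = Σ_z w_z b_{z}`, `b_{xy} = c_{x↑}c_{y↓} − c_{x↓}c_{y↑}`)
and real `U, μ, h`, the pair-sourced grand-canonical Hubbard form RESTRICTED TO A REGION `A ⊆ Λ` is

  `sourcedOn c w U μ h A = V_A(U, μ) − Σ_{b ⊆ A} c_b T_b − h (P_{w|A} + P_{w|A}ᴴ)`

— all on-site terms of `A` and all bonds and pairs with BOTH ends in `A` (the terms of the interaction
inside `A`; for `A = univ` the full Hamiltonian, `sourcedOn_univ_eq_sourced`; for a block of a torus that does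
not wrap around, the open cluster). PROVED here:

* `sourcedOn_mem_carEvenSubalgebra` — `H_A` is an even element of the CAR algebra of the orbitals of `A`;
  `isHermitian_sourcedOn` (for bond-reversal symmetric couplings `c_{(y,x,σ)} = conj c_{(x,y,σ)}`);
* **the cut identity** `sourcedOn_univ_eq_add_sub_straddleOp`:
  `H_Λ = H_A + H_{Λ∖A} − W_A`, `W_A = Σ_{b straddling} c_b T_b + h (P_{w,straddling} + h.c.)` (the bonds and
  pairs with exactly one end in `A`);
* `straddleOp_odd` — `W_A` is ODD under the regional fermion parity `(-1)^{N_A}` (`regionParityOp (orbs A)`);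
* **Ruelle's cut over an arbitrary region** `groundEnergy_sourcedOn_univ_le_add`:
  `E₀(H_Λ) ≤ E₀(H_A) + E₀(H_{Λ∖A})` for EVERY `A ⊆ Λ` — the parity-superselection cut
  `groundEnergy_add_sub_le_of_straddling` of `GradedLocalGroundEnergyCut.lean` (no product states, no
  condition on the position of `A` in the Jordan–Wigner order);
* the graph forms: `hamiltonianWith G t U μ − h(P_w + P_wᴴ) = sourcedOn (hubbardCoupling G t) w U μ h univ`
  and the two-graph (`t–t'`) form (`hamiltonian_add_hamiltonian_sub_eq_sourcedOn_univ`).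

References: D. Ruelle, *Statistical Mechanics: Rigorous Results* (1969), §2.2–2.3 (restriction of an
interaction to a region, boundary terms, sub-box variational principle) [cite: Ruelle1969, §2.2];
O. Bratteli, D. W. Robinson, *Operator Algebras and QSM II* (1997), §5.2.2, §6.2.1 (local Hamiltonians
`H(Λ) = Σ_{X ⊆ Λ} Φ(X)`) [cite: BratteliRobinsonII1997, §6.2.1]; T. Koma, H. Tasaki, J. Stat. Phys. 76 (1994)
745, §1 (the pair-sourced Hamiltonian) [cite: KomaTasaki1994, §1]. All statements are [folklore].

Tree search: `onSiteSum`, `hopSum`, `bondOp_mem`, `hopSum_mem`, `hopSum_add`, `onSiteSum_union`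
(`HubbardBondAlgebra`), `bondPair(_conjTranspose)_mem_carEvenSubalgebra`, `pairSum(_conjTranspose)_mem_carEvenSubalgebra`
(`SourcedHubbardBlockPartitionFunction`), `hamiltonianWith_eq_onSiteSum_sub_hopSum`, `isHermitian_onSiteSum_ofReal`
(`SourcedHubbardBlockCut`), `regionParityOp_*`, `groundEnergy_add_sub_le_of_straddling` (`GradedLocalGroundEnergyCut`) —
all REUSED; `lean search 'sourcedOn|restrictCoupling|straddle'`: nothing.
-/

noncomputable section

open Matrix Finset Literature.Barriers.HubbardSuperconductivity
open scoped ComplexOrder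

namespace Literature.MathematicalPhysics.QuantumLattice

variable {Λ : Type*} [LinearOrder Λ] [Fintype Λ]

/-! ### Restricted and straddling couplings and weights -/

section Restrict

/-- The bond couplings RESTRICTED to the region `A`: `c_b` if both ends of `b` lie in `A`, else `0`
(Ruelle's restriction `Φ|_A` of an interaction). [cite: Ruelle1969, §2.2] -/
def restrictCoupling (A : Finset Λ) (c : Bond Λ → ℂ) : Bond Λ → ℂ :=
  fun b => if b.1 ∈ A ∧ b.2.1 ∈ A then c b else 0

/-- The STRADDLING bond couplings of the region `A`: `c_b` if exactly one end of `b` lies in `A`, else `0`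
(Ruelle's boundary terms `W`). [cite: Ruelle1969, §2.2] -/
def straddleCoupling (A : Finset Λ) (c : Bond Λ → ℂ) : Bond Λ → ℂ :=
  fun b => if ((b.1 ∈ A ∧ b.2.1 ∉ A) ∨ (b.1 ∉ A ∧ b.2.1 ∈ A)) then c b else 0

/-- The pair weights RESTRICTED to the region `A`: `w_{xy}` if `x, y ∈ A`, else `0`. [cite: Ruelle1969, §2.2] -/
def restrictWeight (A : Finset Λ) (w : Λ × Λ → ℂ) : Λ × Λ → ℂ :=
  fun z => if z.1 ∈ A ∧ z.2 ∈ A then w z else 0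

/-- The STRADDLING pair weights of the region `A`: `w_{xy}` if exactly one of `x, y` lies in `A`, else `0`.
[cite: Ruelle1969, §2.2] -/
def straddleWeight (A : Finset Λ) (w : Λ × Λ → ℂ) : Λ × Λ → ℂ :=
  fun z => if ((z.1 ∈ A ∧ z.2 ∉ A) ∨ (z.1 ∉ A ∧ z.2 ∈ A)) then w z else 0

variable (A : Finset Λ) (c : Bond Λ → ℂ) (w : Λ × Λ → ℂ)

omit [Fintype Λ] in
/-- `restrictCoupling` unfolded. [cite: Ruelle1969, §2.2] -/
theorem restrictCoupling_apply (b : Bond Λ) :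
    restrictCoupling A c b = if b.1 ∈ A ∧ b.2.1 ∈ A then c b else 0 := rfl

omit [Fintype Λ] in
/-- `straddleCoupling` unfolded. [cite: Ruelle1969, §2.2] -/
theorem straddleCoupling_apply (b : Bond Λ) :
    straddleCoupling A c b = if ((b.1 ∈ A ∧ b.2.1 ∉ A) ∨ (b.1 ∉ A ∧ b.2.1 ∈ A)) then c b else 0 := rfl

omit [Fintype Λ] in
/-- `restrictWeight` unfolded. [cite: Ruelle1969, §2.2] -/
theorem restrictWeight_apply (z : Λ × Λ) :
    restrictWeight A w z = if z.1 ∈ A ∧ z.2 ∈ A then w z else 0 := rfl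

omit [Fintype Λ] in
/-- `straddleWeight` unfolded. [cite: Ruelle1969, §2.2] -/
theorem straddleWeight_apply (z : Λ × Λ) :
    straddleWeight A w z = if ((z.1 ∈ A ∧ z.2 ∉ A) ∨ (z.1 ∉ A ∧ z.2 ∈ A)) then w z else 0 := rfl

/-- Restriction to the whole volume does nothing. [cite: Ruelle1969, §2.2] -/
@[simp] theorem restrictCoupling_univ : restrictCoupling (Finset.univ : Finset Λ) c = c := by
  funext b; simp [restrictCoupling]

/-- Restriction of the weights to the whole volume does nothing. [cite: Ruelle1969, §2.2] -/
@[simp] theorem restrictWeight_univ : restrictWeight (Finset.univ : Finset Λ) w = w := by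
  funext z; simp [restrictWeight]

/-- Nothing straddles the whole volume. [cite: Ruelle1969, §2.2] -/
@[simp] theorem straddleCoupling_univ : straddleCoupling (Finset.univ : Finset Λ) c = 0 := by
  funext b; simp [straddleCoupling]

/-- Nothing straddles the whole volume (weights). [cite: Ruelle1969, §2.2] -/
@[simp] theorem straddleWeight_univ : straddleWeight (Finset.univ : Finset Λ) w = 0 := by
  funext z; simp [straddleWeight]

/-- **Decomposition of the couplings along the cut**: every bond lies inside `A`, inside `Λ∖A`, or straddles.
[cite: Ruelle1969, §2.2] -/
theorem restrictCoupling_add_compl_add_straddle :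
    restrictCoupling A c + restrictCoupling Aᶜ c + straddleCoupling A c = c := by
  funext b
  simp only [Pi.add_apply, restrictCoupling, straddleCoupling, Finset.mem_compl]
  by_cases h1 : b.1 ∈ A <;> by_cases h2 : b.2.1 ∈ A <;> simp [h1, h2]

/-- Decomposition of the pair weights along the cut. [cite: Ruelle1969, §2.2] -/
theorem restrictWeight_add_compl_add_straddle :
    restrictWeight A w + restrictWeight Aᶜ w + straddleWeight A w = w := by
  funext z
  simp only [Pi.add_apply, restrictWeight, straddleWeight, Finset.mem_compl]
  by_cases h1 : z.1 ∈ A <;> by_cases h2 : z.2 ∈ A <;> simp [h1, h2]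

omit [Fintype Λ] in
/-- A nonzero restricted coupling sits on a bond inside `A`. [cite: Ruelle1969, §2.2] -/
theorem restrictCoupling_ne_zero {A : Finset Λ} {c : Bond Λ → ℂ} {b : Bond Λ} (h : restrictCoupling A c b ≠ 0) :
    b.1 ∈ A ∧ b.2.1 ∈ A := by
  rw [restrictCoupling_apply] at h
  by_contra h'
  exact h (if_neg h')

omit [Fintype Λ] in
/-- A nonzero restricted weight sits on a pair inside `A`. [cite: Ruelle1969, §2.2] -/
theorem restrictWeight_ne_zero {A : Finset Λ} {w : Λ × Λ → ℂ} {z : Λ × Λ} (h : restrictWeight A w z ≠ 0) :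
    z.1 ∈ A ∧ z.2 ∈ A := by
  rw [restrictWeight_apply] at h
  by_contra h'
  exact h (if_neg h')

omit [Fintype Λ] in
/-- Bond-reversal symmetry is inherited by the restricted couplings. [cite: Ruelle1969, §2.2] -/
theorem restrictCoupling_symm {c : Bond Λ → ℂ} (hc : ∀ x y σ, star (c (x, y, σ)) = c (y, x, σ)) (A : Finset Λ)
    (x y : Λ) (σ : Fin 2) : star (restrictCoupling A c (x, y, σ)) = restrictCoupling A c (y, x, σ) := by
  simp only [restrictCoupling]
  by_cases h1 : x ∈ A <;> by_cases h2 : y ∈ A <;> simp [h1, h2, hc]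

omit [Fintype Λ] in
/-- Bond-reversal symmetry is inherited by the straddling couplings. [cite: Ruelle1969, §2.2] -/
theorem straddleCoupling_symm {c : Bond Λ → ℂ} (hc : ∀ x y σ, star (c (x, y, σ)) = c (y, x, σ)) (A : Finset Λ)
    (x y : Λ) (σ : Fin 2) : star (straddleCoupling A c (x, y, σ)) = straddleCoupling A c (y, x, σ) := by
  simp only [straddleCoupling]
  by_cases h1 : x ∈ A <;> by_cases h2 : y ∈ A <;> simp [h1, h2, hc]

end Restrict

/-! ### Hermiticity of a hopping operator with bond-reversal symmetric couplings -/

section Hermitian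

/-- `T_{(x,y,σ)}ᴴ = T_{(y,x,σ)}`. [cite: BratteliRobinsonII1997, §5.2.2] -/
theorem bondOp_conjTranspose (b : Bond Λ) : (bondOp b)ᴴ = bondOp (b.2.1, b.1, b.2.2) := by
  rw [bondOp, conjTranspose_mul, annihilation_conjTranspose, creation_conjTranspose, bondOp]

/-- **A hopping operator with bond-reversal symmetric couplings is Hermitian**:
`c_{(y,x,σ)} = conj c_{(x,y,σ)}` ⇒ `(Σ_b c_b T_b)ᴴ = Σ_b c_b T_b`. [cite: BratteliRobinsonII1997, §6.2.1] -/
theorem isHermitian_hopSum_of_symm {c : Bond Λ → ℂ} (hc : ∀ x y σ, star (c (x, y, σ)) = c (y, x, σ)) :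
    (hopSum c).IsHermitian := by
  unfold IsHermitian hopSum
  rw [conjTranspose_sum]
  simp only [conjTranspose_smul, bondOp_conjTranspose]
  -- reindex by bond reversal
  let e : Bond Λ ≃ Bond Λ :=
    { toFun := fun b => (b.2.1, b.1, b.2.2)
      invFun := fun b => (b.2.1, b.1, b.2.2)
      left_inv := fun b => rfl
      right_inv := fun b => rfl }
  rw [← e.sum_comp]
  refine Finset.sum_congr rfl fun b _ => ?_
  obtain ⟨x, y, σ⟩ := b
  show star (c (y, x, σ)) • bondOp (x, y, σ) = c (x, y, σ) • bondOp (x, y, σ)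
  rw [hc]

end Hermitian

/-! ### The sourced Hubbard form restricted to a region -/

section SourcedOn

/-- **The pair-sourced grand-canonical Hubbard form restricted to the region `A`**:
`H_A = V_A(U, μ) − Σ_{b ⊆ A} c_b T_b − h (P_{w|A} + P_{w|A}ᴴ)` — all on-site terms `U n_{x↑}n_{x↓} − μ n_x`
of `A`, all hopping bonds and all singlet pairs with both ends in `A` (the terms of the interaction inside
`A`, Ruelle's `H_Φ(A)`; Koma–Tasaki's `H_Λ − hO_Λ` for `A = Λ`). [cite: Ruelle1969, §2.2] -/
def sourcedOn (c : Bond Λ → ℂ) (w : Λ × Λ → ℂ) (U μ h : ℝ) (A : Finset Λ) :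
    Matrix (Finset (Orb Λ)) (Finset (Orb Λ)) ℂ :=
  onSiteSum (U : ℂ) (μ : ℂ) A - hopSum (restrictCoupling A c) -
    (h : ℂ) • ((∑ z : Λ × Λ, restrictWeight A w z • bondPair z.1 z.2) +
      (∑ z : Λ × Λ, restrictWeight A w z • bondPair z.1 z.2)ᴴ)

/-- **The straddling operator of the region `A`**: `W_A = Σ_{b straddling} c_b T_b + h (P_{w,straddling} + h.c.)`
(bonds and pairs with exactly one end in `A`; Ruelle's boundary term). [cite: Ruelle1969, §2.2] -/
def straddleOp (c : Bond Λ → ℂ) (w : Λ × Λ → ℂ) (h : ℝ) (A : Finset Λ) :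
    Matrix (Finset (Orb Λ)) (Finset (Orb Λ)) ℂ :=
  hopSum (straddleCoupling A c) +
    (h : ℂ) • ((∑ z : Λ × Λ, straddleWeight A w z • bondPair z.1 z.2) +
      (∑ z : Λ × Λ, straddleWeight A w z • bondPair z.1 z.2)ᴴ)

variable (c : Bond Λ → ℂ) (w : Λ × Λ → ℂ) (U μ h : ℝ)

/-- On the whole volume the restricted form is the full sourced form
`V_Λ(U, μ) − Σ_b c_b T_b − h (P_w + P_wᴴ)`. [cite: Ruelle1969, §2.2] -/
theorem sourcedOn_univ_eq_sourced :
    sourcedOn c w U μ h Finset.univ =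
      onSiteSum (U : ℂ) (μ : ℂ) (Finset.univ : Finset Λ) - hopSum c -
        (h : ℂ) • ((∑ z : Λ × Λ, w z • bondPair z.1 z.2) + (∑ z : Λ × Λ, w z • bondPair z.1 z.2)ᴴ) := by
  rw [sourcedOn, restrictCoupling_univ, restrictWeight_univ]

/-- **Graph form**: the tree's sourced Hamiltonian `hamiltonianWith G t U μ − h(P_w + P_wᴴ)` is
`sourcedOn (hubbardCoupling G t) w U μ h univ`. [cite: KomaTasaki1994, §1] -/
theorem hamiltonianWith_sub_eq_sourcedOn_univ (G : SimpleGraph Λ) [DecidableRel G.Adj] (t : ℝ) :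
    hamiltonianWith G t U μ - (h : ℂ) • ((∑ z : Λ × Λ, w z • bondPair z.1 z.2) + (∑ z : Λ × Λ, w z • bondPair z.1 z.2)ᴴ) =
      sourcedOn (hubbardCoupling G (t : ℂ)) w U μ h Finset.univ := by
  rw [sourcedOn_univ_eq_sourced, hamiltonianWith_eq_onSiteSum_sub_hopSum]

/-- **Two-graph (`t–t'`) form**: `H_G(t,U) + H_{G'}(t',0) − μN − h(P_w + P_wᴴ)
= sourcedOn (hubbardCoupling G t + hubbardCoupling G' t') w U μ h univ`. [cite: KomaTasaki1994, §1] -/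
theorem hamiltonian_add_hamiltonian_sub_eq_sourcedOn_univ (G G' : SimpleGraph Λ) [DecidableRel G.Adj]
    [DecidableRel G'.Adj] (t t' : ℝ) :
    hamiltonian G t U + hamiltonian G' t' 0 - (μ : ℂ) • totalNumber -
        (h : ℂ) • ((∑ z : Λ × Λ, w z • bondPair z.1 z.2) + (∑ z : Λ × Λ, w z • bondPair z.1 z.2)ᴴ) =
      sourcedOn (hubbardCoupling G (t : ℂ) + hubbardCoupling G' (t' : ℂ)) w U μ h Finset.univ := by
  have h1 : hamiltonian G t U - (μ : ℂ) • totalNumber =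
      onSiteSum (U : ℂ) (μ : ℂ) (Finset.univ : Finset Λ) - hopSum (hubbardCoupling G (t : ℂ)) := by
    rw [← hamiltonianWith_eq, hamiltonianWith_eq_onSiteSum_sub_hopSum]
  have h2 : hamiltonian G' t' 0 = -hopSum (hubbardCoupling G' (t' : ℂ)) := by
    have h := hamiltonianWith_eq_onSiteSum_sub_hopSum G' t' 0 0
    rw [hamiltonianWith_zero] at h
    rw [h, Complex.ofReal_zero]
    have h0 : onSiteSum (0 : ℂ) (0 : ℂ) (Finset.univ : Finset Λ) = 0 := by
      unfold onSiteSum onSiteOp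
      simp
    rw [h0, zero_sub]
  rw [sourcedOn_univ_eq_sourced, hopSum_add]
  calc hamiltonian G t U + hamiltonian G' t' 0 - (μ : ℂ) • totalNumber -
        (h : ℂ) • ((∑ z : Λ × Λ, w z • bondPair z.1 z.2) + (∑ z : Λ × Λ, w z • bondPair z.1 z.2)ᴴ)
      = (hamiltonian G t U - (μ : ℂ) • totalNumber) + hamiltonian G' t' 0 -
        (h : ℂ) • ((∑ z : Λ × Λ, w z • bondPair z.1 z.2) + (∑ z : Λ × Λ, w z • bondPair z.1 z.2)ᴴ) := by abel
    _ = _ := by rw [h1, h2]; abel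

/-- **`H_A` is an even element of the CAR algebra of the orbitals of `A`.** [cite: BratteliRobinsonII1997, §6.2.1] -/
theorem sourcedOn_mem_carEvenSubalgebra (A : Finset Λ) :
    sourcedOn c w U μ h A ∈ carEvenSubalgebra (orbs A) := by
  unfold sourcedOn
  refine Subalgebra.sub_mem _ (Subalgebra.sub_mem _ (onSiteSum_mem _ _ subset_rfl)
    (hopSum_mem fun b hb => restrictCoupling_ne_zero hb)) (Subalgebra.smul_mem _ (Subalgebra.add_mem _
      (pairSum_mem_carEvenSubalgebra fun z hz => restrictWeight_ne_zero hz)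
      (pairSum_conjTranspose_mem_carEvenSubalgebra fun z hz => restrictWeight_ne_zero hz)) _)

/-- `H_A` lies in the (full) CAR algebra of the orbitals of `A`. [cite: BratteliRobinsonII1997, §6.2.1] -/
theorem sourcedOn_mem_carSubalgebra (A : Finset Λ) : sourcedOn c w U μ h A ∈ carSubalgebra (orbs A) :=
  carEvenSubalgebra_le_carSubalgebra _ (sourcedOn_mem_carEvenSubalgebra c w U μ h A)

omit [LinearOrder Λ] [Fintype Λ] in
/-- A real multiple of `X + Xᴴ` is Hermitian. [folklore] -/
private theorem isHermitian_real_smul_add_conjTranspose {m : Type*} (r : ℝ) (X : Matrix m m ℂ) :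
    ((r : ℂ) • (X + Xᴴ)).IsHermitian := by
  have hS : (X + Xᴴ).IsHermitian := Matrix.isHermitian_add_transpose_self _
  unfold IsHermitian at hS ⊢
  rw [conjTranspose_smul, hS, Complex.star_def, Complex.conj_ofReal]

/-- **`H_A` is Hermitian** for bond-reversal symmetric couplings and real `U, μ, h`. [cite: Ruelle1969, §2.2] -/
theorem isHermitian_sourcedOn {c : Bond Λ → ℂ} (hc : ∀ x y σ, star (c (x, y, σ)) = c (y, x, σ)) (A : Finset Λ) :
    (sourcedOn c w U μ h A).IsHermitian := by
  unfold sourcedOn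
  exact ((isHermitian_onSiteSum_ofReal U μ A).sub (isHermitian_hopSum_of_symm (restrictCoupling_symm hc A))).sub
    (isHermitian_real_smul_add_conjTranspose h _)

/-- **`W_A` is Hermitian** for bond-reversal symmetric couplings and real `h`. [cite: Ruelle1969, §2.2] -/
theorem isHermitian_straddleOp {c : Bond Λ → ℂ} (hc : ∀ x y σ, star (c (x, y, σ)) = c (y, x, σ)) (A : Finset Λ) :
    (straddleOp c w h A).IsHermitian := by
  unfold straddleOp
  exact (isHermitian_hopSum_of_symm (straddleCoupling_symm hc A)).add (isHermitian_real_smul_add_conjTranspose h _)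

/-! ### The cut identity -/

/-- Pair sums are additive in the weights. [folklore] -/
private theorem pairSum_add (w₁ w₂ : Λ × Λ → ℂ) :
    (∑ z : Λ × Λ, (w₁ + w₂) z • bondPair z.1 z.2) =
      (∑ z : Λ × Λ, w₁ z • bondPair z.1 z.2) + ∑ z : Λ × Λ, w₂ z • bondPair z.1 z.2 := by
  simp only [Pi.add_apply, add_smul, Finset.sum_add_distrib]

omit [LinearOrder Λ] [Fintype Λ] in
/-- The additive bookkeeping of the cut. [folklore] -/
private theorem cut_bookkeeping {M : Type*} [AddCommGroup M] [Module ℂ M] (k : ℂ)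
    (VA VB TA TB TS PA PB PS QA QB QS : M) :
    VA + VB - (TA + TB + TS) - k • ((PA + PB + PS) + (QA + QB + QS)) =
      (VA - TA - k • (PA + QA)) + (VB - TB - k • (PB + QB)) - (TS + k • (PS + QS)) := by
  simp only [smul_add]
  abel

/-- **The cut identity**: `H_Λ = H_A + H_{Λ∖A} − W_A` — every on-site term lies in `A` or in `Λ∖A`; every
bond and every pair lies inside `A`, inside `Λ∖A`, or straddles (Ruelle: `U_Φ(Λ₁ ∪ Λ₂) = U_Φ(Λ₁) + U_Φ(Λ₂) + W`).
[cite: Ruelle1969, §2.2] -/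
theorem sourcedOn_univ_eq_add_sub_straddleOp (A : Finset Λ) :
    sourcedOn c w U μ h Finset.univ = sourcedOn c w U μ h A + sourcedOn c w U μ h Aᶜ - straddleOp c w h A := by
  have hV : onSiteSum (U : ℂ) (μ : ℂ) (Finset.univ : Finset Λ) = onSiteSum (U : ℂ) (μ : ℂ) A + onSiteSum (U : ℂ) (μ : ℂ) Aᶜ := by
    rw [← onSiteSum_union _ _ disjoint_compl_right, Finset.union_compl]
  have hT : hopSum c = hopSum (restrictCoupling A c) + hopSum (restrictCoupling Aᶜ c) + hopSum (straddleCoupling A c) := by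
    conv_lhs => rw [← restrictCoupling_add_compl_add_straddle A c]
    rw [hopSum_add, hopSum_add]
  have hP : (∑ z : Λ × Λ, w z • bondPair z.1 z.2) =
      (∑ z : Λ × Λ, restrictWeight A w z • bondPair z.1 z.2) + (∑ z : Λ × Λ, restrictWeight Aᶜ w z • bondPair z.1 z.2) +
        ∑ z : Λ × Λ, straddleWeight A w z • bondPair z.1 z.2 := by
    conv_lhs => rw [← restrictWeight_add_compl_add_straddle A w]
    rw [pairSum_add, pairSum_add]
  rw [sourcedOn_univ_eq_sourced, hV, hT, hP, sourcedOn, sourcedOn, straddleOp, conjTranspose_add, conjTranspose_add]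
  exact cut_bookkeeping (h : ℂ) _ _ _ _ _ _ _ _ _ _ _

/-! ### The straddling operator is odd under the regional parity -/

/-- `T_{(x,y,σ)} = l_{(xσ,†)} l_{(yσ)}` as a product of two Jordan–Wigner letters. [folklore] -/
private theorem bondOp_eq_letterOp_mul (b : Bond Λ) :
    bondOp b = letterOp (orb b.1 b.2.2, true) * letterOp (orb b.2.1 b.2.2, false) := by
  simp [bondOp, letterOp]

/-- `c_{uσ} c_{vτ}` as a product of two letters. [folklore] -/
private theorem annihilation_mul_eq_letterOp_mul (i j : Orb Λ) :
    annihilation i * annihilation j = letterOp (i, false) * letterOp (j, false) := by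
  simp [letterOp]

/-- A straddling hopping term is odd under `(-1)^{N_A}`. [cite: BratteliRobinsonII1997, §5.2.2] -/
theorem regionParityOp_conj_bondOp_of_xor {A : Finset Λ} {b : Bond Λ} (hb : ((b.1 ∈ A ∧ b.2.1 ∉ A) ∨ (b.1 ∉ A ∧ b.2.1 ∈ A))) :
    regionParityOp (orbs A) * bondOp b * regionParityOp (orbs A) = -bondOp b := by
  rw [bondOp_eq_letterOp_mul]
  rcases hb with ⟨h1, h2⟩ | ⟨h1, h2⟩
  · exact regionParityOp_mul_letterOp_mul_letterOp_mul_regionParityOp _ (orb_mem_orbs.2 h1)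
      (fun h => h2 (orb_mem_orbs.1 h))
  · exact regionParityOp_mul_letterOp_mul_letterOp_mul_regionParityOp' _ (orb_mem_orbs.2 h2)
      (fun h => h1 (orb_mem_orbs.1 h))

/-- A straddling singlet pair is odd under `(-1)^{N_A}`. [cite: BratteliRobinsonII1997, §5.2.2] -/
theorem regionParityOp_conj_bondPair_of_xor {A : Finset Λ} {u v : Λ} (huv : ((u ∈ A ∧ v ∉ A) ∨ (u ∉ A ∧ v ∈ A))) :
    regionParityOp (orbs A) * bondPair u v * regionParityOp (orbs A) = -bondPair u v := by
  unfold bondPair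
  rw [annihilation_mul_eq_letterOp_mul, annihilation_mul_eq_letterOp_mul]
  refine regionParityOp_odd_sub ?_ ?_
  · rcases huv with ⟨h1, h2⟩ | ⟨h1, h2⟩
    · exact regionParityOp_mul_letterOp_mul_letterOp_mul_regionParityOp _ (orb_mem_orbs.2 h1)
        (fun h => h2 (orb_mem_orbs.1 h))
    · exact regionParityOp_mul_letterOp_mul_letterOp_mul_regionParityOp' _ (orb_mem_orbs.2 h2)
        (fun h => h1 (orb_mem_orbs.1 h))
  · rcases huv with ⟨h1, h2⟩ | ⟨h1, h2⟩
    · exact regionParityOp_mul_letterOp_mul_letterOp_mul_regionParityOp _ (orb_mem_orbs.2 h1)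
        (fun h => h2 (orb_mem_orbs.1 h))
    · exact regionParityOp_mul_letterOp_mul_letterOp_mul_regionParityOp' _ (orb_mem_orbs.2 h2)
        (fun h => h1 (orb_mem_orbs.1 h))

/-- **`W_A` is odd under the regional parity `(-1)^{N_A}`.** [cite: BratteliRobinsonII1997, §5.2.2] -/
theorem straddleOp_odd (A : Finset Λ) :
    regionParityOp (orbs A) * straddleOp c w h A * regionParityOp (orbs A) = -straddleOp c w h A := by
  unfold straddleOp hopSum
  refine regionParityOp_odd_add (regionParityOp_odd_sum _ fun b _ => ?_) (regionParityOp_odd_smul _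
    (regionParityOp_odd_add (regionParityOp_odd_sum _ fun z _ => ?_)
      (regionParityOp_odd_conjTranspose (regionParityOp_odd_sum _ fun z _ => ?_))))
  · by_cases hb : ((b.1 ∈ A ∧ b.2.1 ∉ A) ∨ (b.1 ∉ A ∧ b.2.1 ∈ A))
    · exact regionParityOp_odd_smul _ (regionParityOp_conj_bondOp_of_xor hb)
    · rw [straddleCoupling_apply, if_neg hb, zero_smul, Matrix.mul_zero, Matrix.zero_mul, neg_zero]
  all_goals
    by_cases hz : ((z.1 ∈ A ∧ z.2 ∉ A) ∨ (z.1 ∉ A ∧ z.2 ∈ A))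
    · exact regionParityOp_odd_smul _ (regionParityOp_conj_bondPair_of_xor hz)
    · rw [straddleWeight_apply, if_neg hz, zero_smul, Matrix.mul_zero, Matrix.zero_mul, neg_zero]

/-! ### Ruelle's cut over an arbitrary region -/

/-- **Ruelle's cut for pair-sourced Hubbard Hamiltonians over an ARBITRARY region**: for bond-reversal
symmetric couplings, real `U, μ, h` and every `A ⊆ Λ`,
`E₀(H_Λ) ≤ E₀(H_A) + E₀(H_{Λ∖A})` — a parity-definite joint ground vector of the commuting pair
`H_A, H_{Λ∖A}` is a trial state for `H_Λ` in which every straddling term has zero expectation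
(`groundEnergy_add_sub_le_of_straddling`). [cite: Ruelle1969, §2.2] -/
theorem groundEnergy_sourcedOn_univ_le_add {c : Bond Λ → ℂ} (hc : ∀ x y σ, star (c (x, y, σ)) = c (y, x, σ))
    (w : Λ × Λ → ℂ) (U μ h : ℝ) (A : Finset Λ) :
    (sourcedOn c w U μ h Finset.univ).groundEnergy ≤
      (sourcedOn c w U μ h A).groundEnergy + (sourcedOn c w U μ h Aᶜ).groundEnergy := by
  rw [sourcedOn_univ_eq_add_sub_straddleOp c w U μ h A]
  exact groundEnergy_add_sub_le_of_straddling (sourcedOn_mem_carEvenSubalgebra c w U μ h A)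
    (sourcedOn_mem_carSubalgebra c w U μ h Aᶜ) (disjoint_orbs disjoint_compl_right)
    (isHermitian_sourcedOn w U μ h hc A) (isHermitian_sourcedOn w U μ h hc Aᶜ) (isHermitian_straddleOp w h hc A)
    (straddleOp_odd c w h A)

/-- The same cut read as a LOWER bound on the region: `E₀(H_A) ≥ E₀(H_Λ) − E₀(H_{Λ∖A})`.
[cite: Ruelle1969, §2.2] -/
theorem groundEnergy_sourcedOn_ge_univ_sub_compl {c : Bond Λ → ℂ} (hc : ∀ x y σ, star (c (x, y, σ)) = c (y, x, σ))
    (w : Λ × Λ → ℂ) (U μ h : ℝ) (A : Finset Λ) :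
    (sourcedOn c w U μ h Finset.univ).groundEnergy - (sourcedOn c w U μ h Aᶜ).groundEnergy ≤
      (sourcedOn c w U μ h A).groundEnergy := by
  linarith [groundEnergy_sourcedOn_univ_le_add hc w U μ h A]

end SourcedOn

end Literature.MathematicalPhysics.QuantumLattice
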